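import Literature.NumberTheory.EllipticCurves.LocalH1TateDualityLangTateProofs
import Literature.NumberTheory.Automorphic.AdicCompletionLocalField
import HarnessLib

/-!
# LP-B input: the map of completions `K_v → L_w` restricts to the valuation rings and sends the
# maximal ideal into the maximal ideal (cell `b2b-bsdres`, unit `b2b-bsdres-eisenstein-p1`, gen 19;
# X1R0-GAPMAP §28.4 (LP-B), memo `V76-LOCAL-TERM-PLAN.md` §5.3–5.5)

HONEST FRAMING (run/shared/lean/b2b/bsd-rank1-residual/, verbatim in every file): the goal of the
cell is to DELETE the COMBINATION-SHAPED residual classes of the Birch–Swinnerton-Dyer formula for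
ALL analytic-rank `≤ 1` elliptic curves over `ℚ` — "full BSD formula for every rank `≤ 1` curve in
class `C`" assembled STRICTLY from published theorems — so that the rank-`≤ 1` remainder becomes
exactly the CONSTRUCTION-SHAPED classes, which are TYPED (missing-input `Prop`s), NOT attempted.
This is not "finishing BSD". Sub-cell `b2b-bsdres-eisenstein-p1`: research route; NO CLAIM BEYOND
STATED CLASSES; nothing here changes a label; nothing is booked. THEOREMS ONLY — pure local-field
plumbing, nothing about any curve.

## What and why

`X1/InertiaTransport.lean` (the shell of the inertia bridge) takes a ring homomorphism
`g : 𝒪[E] → 𝒪[E']` over the embedding of local fields `f : E → E'`, sending `𝓂[E]` into `𝓂[E']`.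
For the completions `E = K_v`, `E' = L_w` of number fields `K ⊆ L` at places `w ∣ v` and
`f = adicCompletionMap` (the tree's `K_v → L_w`), this file supplies `g`
(`exists_integerHom_adicCompletionMap`): `|f x|_w = |x|_v^{e(w∣v)}` (tree
`valued_adicCompletionMap`), so `f` preserves `|·| ≤ 1` and `|·| < 1`; the valuation ring `𝒪[K_v]`
of the `ValuativeRel` structure is the closed unit ball of `Valued.v` (compatibility of the two
valuations, Mathlib `Valuation.vle_one_iff` / `vlt_one_iff`). §2: **`‖f a‖_w = ‖a‖_v ^ c` for
some `c > 0`** (`exists_norm_adicCompletionMap_eq_rpow`; change of `toNNReal` base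
`toNNReal_eq_rpow`) — the input that makes Mathlib's uniqueness of the spectral norm
(`spectralNorm_unique_field_norm_ext`) applicable to the remaining transport fact LP-B (b)
(`𝒪_{L_w}` integral over `𝒪_{K_v}`; memo §5.6).

References: [SerreLocalFields1979] Ch. II §3; [NeukirchANT1999] Ch. II (8.2)–(8.5).
-/

noncomputable section

open scoped ValuativeRel NNReal
open NumberField IsDedekindDomain WithZeroMulInt Literature.NumberTheory.EllipticCurves

universe u

namespace Summit.BirchSwinnertonDyer.Rank1Residual.X1.AdicCompletionIntegerHom

variable {K : Type u} [Field K] [NumberField K] (L : Type u) [Field L] [NumberField L] [Algebra K L]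
  (v : HeightOneSpectrum (𝓞 K)) (w : HeightOneSpectrum (𝓞 L)) [w.asIdeal.LiesOver v.asIdeal]

/-- On `K_v`: `valuation K_v x ≤ 1 ↔ Valued.v x ≤ 1` (both valuations are compatible with the
valuative relation). [folklore] -/
theorem valuation_le_one_iff (x : v.adicCompletion K) :
    ValuativeRel.valuation (v.adicCompletion K) x ≤ 1 ↔ Valued.v x ≤ 1 := by
  rw [← Valuation.vle_one_iff (ValuativeRel.valuation (v.adicCompletion K)),
    Valuation.vle_one_iff (Valued.v : Valuation (v.adicCompletion K) (WithZero (Multiplicative ℤ)))]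

/-- On `K_v`: `valuation K_v x < 1 ↔ Valued.v x < 1`. [folklore] -/
theorem valuation_lt_one_iff (x : v.adicCompletion K) :
    ValuativeRel.valuation (v.adicCompletion K) x < 1 ↔ Valued.v x < 1 := by
  rw [← Valuation.vlt_one_iff (ValuativeRel.valuation (v.adicCompletion K)),
    Valuation.vlt_one_iff (Valued.v : Valuation (v.adicCompletion K) (WithZero (Multiplicative ℤ)))]

/-- `K_v → L_w` maps the valuation ring into the valuation ring (`|f x|_w = |x|_v^e`).
[cite: SerreLocalFields1979, Ch. II §3] -/
theorem adicCompletionMap_mem_integer {x : v.adicCompletion K} (hx : x ∈ 𝒪[v.adicCompletion K]) :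
    adicCompletionMap (K := K) L v w x ∈ 𝒪[w.adicCompletion L] := by
  have h1 : Valued.v x ≤ 1 := (valuation_le_one_iff v x).mp hx
  change ValuativeRel.valuation (w.adicCompletion L) _ ≤ 1
  rw [valuation_le_one_iff w, valued_adicCompletionMap L v w x]
  exact pow_le_one₀ zero_le h1

/-- **The restriction `g : 𝒪[K_v] →+* 𝒪[L_w]` of `K_v → L_w`, sending `𝓂[K_v]` into `𝓂[L_w]`** —
the input `(g, hg, hg𝓂)` of `X1/InertiaTransport.transportAut_mem_absInertia` for completions of
number fields. [cite: SerreLocalFields1979, Ch. II §3] [cite: NeukirchANT1999, Ch. II (8.2)] -/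
theorem exists_integerHom_adicCompletionMap :
    ∃ g : 𝒪[v.adicCompletion K] →+* 𝒪[w.adicCompletion L],
      (∀ a : 𝒪[v.adicCompletion K], ((g a : 𝒪[w.adicCompletion L]) : w.adicCompletion L) =
        adicCompletionMap (K := K) L v w (a : v.adicCompletion K)) ∧
      ∀ a ∈ 𝓂[v.adicCompletion K], g a ∈ 𝓂[w.adicCompletion L] := by
  refine ⟨(adicCompletionMap (K := K) L v w).restrict 𝒪[v.adicCompletion K] 𝒪[w.adicCompletion L]
    (fun x hx ↦ adicCompletionMap_mem_integer L v w hx), fun _ ↦ rfl, fun a ha ↦ ?_⟩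
  rw [IsLocalRing.mem_maximalIdeal, mem_nonunits_iff,
    Valuation.Integer.not_isUnit_iff_valuation_lt_one] at ha ⊢
  have h1 : Valued.v (a : v.adicCompletion K) < 1 := (valuation_lt_one_iff v _).mp ha
  exact (valuation_lt_one_iff w _).mpr (valued_adicCompletionMap_lt_one L v w h1)

/-! ## §2. `‖f a‖_w = ‖a‖_v ^ c`: the input for the uniqueness of the spectral norm (LP-B (b)) -/

omit [NumberField K] [NumberField L] [Algebra K L] [w.asIdeal.LiesOver v.asIdeal] in
/-- Change of base for `WithZeroMulInt.toNNReal`: for bases `b, b' > 1`,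
`toNNReal_{b'} x = (toNNReal_b x) ^ (log b' / log b)` as real numbers. [folklore] -/
theorem toNNReal_eq_rpow {b b' : ℝ≥0} (hb0 : b ≠ 0) (hb'0 : b' ≠ 0) (hb : 1 < b) (hb' : 1 < b')
    (x : WithZero (Multiplicative ℤ)) :
    ((toNNReal hb'0 x : ℝ≥0) : ℝ) =
      (((toNNReal hb0 x : ℝ≥0) : ℝ)) ^ (Real.log b' / Real.log b) := by
  have hb0' : (0 : ℝ) < b := by exact_mod_cast (zero_lt_one.trans hb)
  have hb'0' : (0 : ℝ) < b' := by exact_mod_cast (zero_lt_one.trans hb')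
  have hlogb : Real.log b ≠ 0 := Real.log_ne_zero_of_pos_of_ne_one hb0' (by exact_mod_cast hb.ne')
  have hκ : 0 < Real.log b' / Real.log b :=
    div_pos (Real.log_pos (by exact_mod_cast hb')) (Real.log_pos (by exact_mod_cast hb))
  rcases eq_or_ne x 0 with rfl | hx
  · simp only [map_zero, NNReal.coe_zero]
    rw [Real.zero_rpow hκ.ne']
  · rw [toNNReal_neg_apply _ hx, toNNReal_neg_apply _ hx]
    push_cast
    rw [← Real.rpow_intCast, ← Real.rpow_intCast, ← Real.rpow_mul hb0'.le]
    rw [Real.rpow_def_of_pos hb0', Real.rpow_def_of_pos hb'0']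
    congr 1
    field_simp

/-- **`‖f a‖_w = ‖a‖_v ^ c` for a constant `c > 0`** (`f = adicCompletionMap : K_v → L_w`;
`c = e(w∣v) · log Nw / log Nv`): `Valued.v (f a) = Valued.v a ^ e` (tree `valued_adicCompletionMap`)
and both norms are `toNNReal` of `Valued.v` in the bases `Nv`, `Nw` (Mathlib
`NumberField.FinitePlace.norm_def`). This is the input making `‖·‖_w^{1/c}` (resp. the pulled-back
spectral norm) an extension of `‖·‖_v`, to which Mathlib's `spectralNorm_unique_field_norm_ext`
applies — the route to LP-B (b) (memo §5.6). [cite: NeukirchANT1999, Ch. II (4.8), (8.2)] -/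
theorem exists_norm_adicCompletionMap_eq_rpow :
    ∃ c : ℝ, 0 < c ∧ ∀ a : v.adicCompletion K,
      ‖adicCompletionMap (K := K) L v w a‖ = ‖a‖ ^ c := by
  have hv1 := NumberField.HeightOneSpectrum.one_lt_absNorm_nnreal v
  have hw1 := NumberField.HeightOneSpectrum.one_lt_absNorm_nnreal w
  set κ : ℝ := Real.log (Ideal.absNorm w.asIdeal : ℝ≥0) / Real.log (Ideal.absNorm v.asIdeal : ℝ≥0)
  have hκ : 0 < κ :=
    div_pos (Real.log_pos (by exact_mod_cast hw1)) (Real.log_pos (by exact_mod_cast hv1))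
  have he := ramificationIdx_pos_of_liesOver L v w
  refine ⟨κ * (w.asIdeal.ramificationIdx (𝓞 K) : ℝ), mul_pos hκ (by exact_mod_cast he), fun a ↦ ?_⟩
  rw [NumberField.FinitePlace.norm_def, NumberField.FinitePlace.norm_def,
    valued_adicCompletionMap L v w a, map_pow, NNReal.coe_pow,
    toNNReal_eq_rpow (NumberField.HeightOneSpectrum.absNorm_ne_zero v)
      (NumberField.HeightOneSpectrum.absNorm_ne_zero w) hv1 hw1,
    ← Real.rpow_natCast, ← Real.rpow_mul (NNReal.coe_nonneg _)]

end Summit.BirchSwinnertonDyer.Rank1Residual.X1.AdicCompletionIntegerHom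

end
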